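import Mathlib

/-!
# Stub `stub_truncatedConvergence` — bounded convergence of the truncated contact transforms

For monotone functions `F N : ℝ → ℝ` vanishing on `(-∞, 0]`, pointwise bounded uniformly in `N`, and converging
to a monotone `G` at every continuity point `t > 0` of `G`, the truncated transforms against the contact kernel
`k_γ(t) = 2t/(γ²+t²)²`,
`∫_(0,R] F N t · k_γ t dt`, converge to `∫_(0,R] G t · k_γ t dt`.

Proof: dominated convergence on the finite window `(0,R]` with the integrable bound `C_R · k_γ`
(`0 ≤ F N t ≤ F N R ≤ C_R` on `(0,R]` by monotonicity and `F N 0 = 0`); almost-everywhere convergence holds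
because the discontinuity set of the monotone `G` is countable (`Monotone.countable_not_continuousAt`), hence
Lebesgue-null.
-/

namespace Summit.AtomisticToContinuum.FouriersLaw.Theorems.ContactMeasureLimit

open MeasureTheory Filter Set Topology

/-- The contact kernel `t ↦ 2t/(γ²+t²)²` is continuous for `γ > 0`. -/
theorem truncated_kernel_continuous {γ : ℝ} (hγ : 0 < γ) :
    Continuous fun t : ℝ => 2 * t / (γ ^ 2 + t ^ 2) ^ 2 :=
  Continuous.div (by fun_prop) (by fun_prop) fun t => by positivity

/-- The contact kernel `t ↦ 2t/(γ²+t²)²` is nonnegative for `t ≥ 0`. -/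
theorem truncated_kernel_nonneg (γ : ℝ) {t : ℝ} (ht : 0 ≤ t) :
    0 ≤ 2 * t / (γ ^ 2 + t ^ 2) ^ 2 := by
  positivity

/-- A monotone function vanishing on `(-∞,0]` is nonnegative on `(0, ∞)`. -/
theorem truncated_nonneg_of_monotone {f : ℝ → ℝ} (hf : Monotone f) (hf0 : ∀ s : ℝ, s ≤ 0 → f s = 0)
    {t : ℝ} (ht : 0 < t) : 0 ≤ f t := by
  have h := hf ht.le
  rwa [hf0 0 le_rfl] at h

/-- For a monotone `G : ℝ → ℝ`, Lebesgue-almost every point is a continuity point of `G`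
(the discontinuity set is countable). -/
theorem truncated_ae_continuousAt {G : ℝ → ℝ} (hG : Monotone G) :
    ∀ᵐ t ∂(volume : Measure ℝ), ContinuousAt G t := by
  have hS : (volume : Measure ℝ) {t : ℝ | ¬ContinuousAt G t} = 0 :=
    hG.countable_not_continuousAt.measure_zero _
  rw [ae_iff]
  exact hS

/-- **Bounded convergence on a finite window.** For monotone `F N` vanishing on `(-∞,0]`, pointwise bounded
uniformly in `N`, converging to the monotone `G` at every continuity point `t > 0` of `G`, the truncated contact
transforms `∫_(0,R] F N · k_γ` converge to `∫_(0,R] G · k_γ`, `k_γ(t) = 2t/(γ²+t²)²` (dominated convergence with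
bound `C_R · k_γ`, a.e. convergence off the countable discontinuity set of `G`). -/
theorem stub_truncatedConvergence :
    ∀ (F : ℕ → ℝ → ℝ) (G : ℝ → ℝ), (∀ N : ℕ, Monotone (F N)) → (∀ (N : ℕ) (s : ℝ), s ≤ 0 → F N s = 0) →
      Monotone G → (∀ t : ℝ, ∃ C : ℝ, ∀ N : ℕ, F N t ≤ C) →
      (∀ t : ℝ, 0 < t → ContinuousAt G t →
        Filter.Tendsto (fun N : ℕ => F N t) Filter.atTop (nhds (G t))) →
      ∀ γ R : ℝ, 0 < γ → 0 < R →
        Filter.Tendsto (fun N : ℕ => ∫ t in Set.Ioc (0 : ℝ) R, F N t * (2 * t / (γ ^ 2 + t ^ 2) ^ 2))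
          Filter.atTop (nhds (∫ t in Set.Ioc (0 : ℝ) R, G t * (2 * t / (γ ^ 2 + t ^ 2) ^ 2))) := by
  intro F G hF hF0 hG hbd hlim γ R hγ _hR
  obtain ⟨C, hC⟩ := hbd R
  have hk : Continuous fun t : ℝ => 2 * t / (γ ^ 2 + t ^ 2) ^ 2 := truncated_kernel_continuous hγ
  refine MeasureTheory.tendsto_integral_of_dominated_convergence
    (fun t => C * (2 * t / (γ ^ 2 + t ^ 2) ^ 2)) ?_ ?_ ?_ ?_
  · intro N
    exact ((hF N).measurable.mul hk.measurable).aestronglyMeasurable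
  · exact (continuous_const.mul hk).integrableOn_Ioc
  · intro N
    refine (ae_restrict_iff' measurableSet_Ioc).2 (Filter.Eventually.of_forall fun t ht => ?_)
    have hk0 : 0 ≤ 2 * t / (γ ^ 2 + t ^ 2) ^ 2 := truncated_kernel_nonneg γ ht.1.le
    have hFt : 0 ≤ F N t := truncated_nonneg_of_monotone (hF N) (hF0 N) ht.1
    rw [Real.norm_eq_abs, abs_of_nonneg (mul_nonneg hFt hk0)]
    exact mul_le_mul_of_nonneg_right (((hF N) ht.2).trans (hC N)) hk0
  · have hae : ∀ᵐ t ∂(volume.restrict (Set.Ioc (0 : ℝ) R)), ContinuousAt G t :=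
      ae_restrict_of_ae (truncated_ae_continuousAt hG)
    filter_upwards [hae, ae_restrict_mem measurableSet_Ioc] with t hcont ht
    exact (hlim t ht.1 hcont).mul_const _

end Summit.AtomisticToContinuum.FouriersLaw.Theorems.ContactMeasureLimit
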